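import Summits.NavierStokesRegularity.NavierStokesRegularity.Theorems.OddMorawetzOddMorawetzLocalJetDecayCutoff
import Summits.NavierStokesRegularity.NavierStokesRegularity.Theorems.OddMorawetzOddMorawetzLocalJetDecaySymbol

/-!
# Jet decay for `OddMorawetzLocal` (stmt-NavierStokesRegularity-1376), III: the kernel estimate

Support file for the birth-skeleton stub `stub_jetDecay` of the crux `OddMorawetzLocal`.  **Kernel estimate**
(`fourier_decay_of_symbol_estimates`): if `F : ℝ³ → ℂ` is smooth off the origin with `|ξ|ᵐ ‖DᵐF(ξ)‖ ≤ Cₘ |ξ|` on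
the punctured unit ball and `|ξ|⁴ ‖DᵐF(ξ)‖ ≤ C'ₘ` off it, then `F ∈ L¹` and `(1 + |x|)⁴ |𝓕F(x)| ≤ C` — the
classical fact that the kernel of a multiplier homogeneous of degree `1` and smooth on the sphere, applied to a
Schwartz function, is `O(|x|^{-d-1})` (T. Tao, J. Amer. Math. Soc. 29 (2016), §1.1, display after (1.8), `d = 3`).
Proof: for `|x| = R ≥ 1`, split `F = χ(R·)F + (1 - χ(R·))F` with the smooth cutoff of file I; the near piece has
`‖χ(R·)F‖₁ ≤ C₀ R⁻¹ vol B(0, R⁻¹) = O(R⁻⁴)` (`norm_fourier_near_piece_le`); the far piece is smooth on `ℝ³`, and five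
integrations by parts (Mathlib's `Real.pow_mul_norm_iteratedFDeriv_fourier_le`) give
`R⁵ |𝓕[(1-χ(R·))F](x)| ≤ 32 ∑_{m ≤ 5} ‖Dᵐ[(1-χ(R·))F]‖₁ = O(R)` through the majorant of file I
(`norm_iteratedFDeriv_far_piece_le`, `pow_mul_norm_fourier_far_piece_le`).  Combined with file II:
`fourier_decay_of_homogeneous` (homogeneous symbol of degree `≥ 1` times Schwartz).  Everything is proved; no
definitions.
-/

noncomputable section

open MeasureTheory Filter Topology Set FourierTransform Metric Complex VectorFourier
open Literature.Analysis Literature.Analysis.FluidPDE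
open scoped Real RealInnerProductSpace ContDiff SchwartzMap LineDeriv

-- the problem namespace `Summit.NavierStokesRegularity.NavierStokesRegularity` repeats the summit name by design (D-0017)
set_option linter.dupNamespace false

namespace Summit.NavierStokesRegularity.NavierStokesRegularity.Theorems

namespace JetDecay

/-- Frequency / physical space `ℝ³`. -/
local notation "E3" => EuclideanSpace ℝ (Fin 3)

/-! ### The far piece `(1 - χ(R·)) F` -/

/-- Majorant of `Dᵐ[(1 - χ(R·))F]`, `m ≤ 5`, `R ≥ 1`: a rescaled Japanese bracket plus a multiple of the
indicator of the ball of radius `R⁻¹`. -/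
theorem norm_iteratedFDeriv_far_piece_le {F : E3 → ℂ} (hF : ContDiffOn ℝ ∞ F {0}ᶜ)
    (Cn Cf : ℕ → ℝ) (hCn0 : ∀ j, 0 ≤ Cn j) (hCf0 : ∀ j, 0 ≤ Cf j)
    (hCn : ∀ j (ξ : E3), ξ ≠ 0 → ‖ξ‖ ≤ 1 → ‖ξ‖ ^ j * ‖iteratedFDeriv ℝ j F ξ‖ ≤ Cn j * ‖ξ‖)
    (hCf : ∀ j (ξ : E3), 1 ≤ ‖ξ‖ → ‖ξ‖ ^ 4 * ‖iteratedFDeriv ℝ j F ξ‖ ≤ Cf j)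
    {χ : E3 → ℝ} (hχ : ContDiff ℝ ∞ χ) (hχ1 : ∀ η, ‖η‖ ≤ 2⁻¹ → χ η = 1)
    (hχ0 : ∀ η, 1 ≤ ‖η‖ → χ η = 0) (Mχ : ℕ → ℝ) (hMχ : ∀ i η, ‖iteratedFDeriv ℝ i χ η‖ ≤ Mχ i)
    {R : ℝ} (hR : 1 ≤ R) {m : ℕ} (hm : m ≤ 5) (ξ : E3) :
    ‖iteratedFDeriv ℝ m (fun η => F η - χ (R • η) • F η) ξ‖ ≤
      (Cn m + Cf m) * (16 * (2 * R) ^ 4 * (1 + ‖(2 * R) • ξ‖) ^ (-(4 : ℝ))) +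
        (∑ i ∈ Finset.range (m + 1), (m.choose i : ℝ) * Mχ i * (Cn (m - i) * 2 ^ (m - i))) *
          (R ^ m * R⁻¹) * (closedBall (0 : E3) R⁻¹).indicator (fun _ => (1 : ℝ)) ξ := by
  have hR0 : 0 < R := by linarith
  have h2R : 0 < 2 * R := by positivity
  have hM0 : ∀ i, 0 ≤ Mχ i := fun i => (norm_nonneg _).trans (hMχ i 0)
  have hθ : ContDiff ℝ ∞ (fun η : E3 => χ (R • η)) := hχ.comp (contDiff_const_smul R)
  -- nonnegativity of the right-hand side
  have hL0 : 0 ≤ ∑ i ∈ Finset.range (m + 1), (m.choose i : ℝ) * Mχ i * (Cn (m - i) * 2 ^ (m - i)) :=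
    Finset.sum_nonneg fun i _ => by
      have := hM0 i; have := hCn0 (m - i); positivity
  have hind0 : 0 ≤ (closedBall (0 : E3) R⁻¹).indicator (fun _ => (1 : ℝ)) ξ :=
    Set.indicator_nonneg (fun _ _ => zero_le_one) ξ
  have hrhs0 : 0 ≤ (Cn m + Cf m) * (16 * (2 * R) ^ 4 * (1 + ‖(2 * R) • ξ‖) ^ (-(4 : ℝ))) +
      (∑ i ∈ Finset.range (m + 1), (m.choose i : ℝ) * Mχ i * (Cn (m - i) * 2 ^ (m - i))) *
        (R ^ m * R⁻¹) * (closedBall (0 : E3) R⁻¹).indicator (fun _ => (1 : ℝ)) ξ := by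
    have := hCn0 m; have := hCf0 m
    positivity
  by_cases hsmall : ‖ξ‖ < (2 * R)⁻¹
  · -- the far piece vanishes near `ξ`
    have hev : (fun η => F η - χ (R • η) • F η) =ᶠ[𝓝 ξ] fun _ => (0 : ℂ) := by
      filter_upwards [comp_smul_eventuallyEq_one hχ1 hR0 hsmall] with η hη
      rw [hη, one_smul, sub_self]
    rw [(hev.iteratedFDeriv ℝ m).eq_of_nhds, iteratedFDeriv_fun_zero, Pi.zero_apply, norm_zero]
    exact hrhs0
  push Not at hsmall
  have ht : 0 < ‖ξ‖ := lt_of_lt_of_le (by positivity) hsmall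
  have hξ : ξ ≠ 0 := norm_pos_iff.1 ht
  have hFat : ContDiffAt ℝ ∞ F ξ := hF.contDiffAt (isOpen_compl_singleton.mem_nhds hξ)
  have hF1at : ContDiffAt ℝ ∞ (fun η => χ (R • η) • F η) ξ := hθ.contDiffAt.smul hFat
  -- split `Dᵐ[(1-χ_R)F] = DᵐF - Dᵐ[χ_R F]`
  have hsub : iteratedFDeriv ℝ m (fun η => F η - χ (R • η) • F η) ξ =
      iteratedFDeriv ℝ m F ξ - iteratedFDeriv ℝ m (fun η => χ (R • η) • F η) ξ := by
    exact iteratedFDeriv_sub_apply (i := m) (hFat.of_le (by exact_mod_cast le_top))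
      (hF1at.of_le (by exact_mod_cast le_top))
  -- the first term
  have hT1 : ‖iteratedFDeriv ℝ m F ξ‖ ≤
      (Cn m + Cf m) * (16 * (2 * R) ^ 4 * (1 + ‖(2 * R) • ξ‖) ^ (-(4 : ℝ))) := by
    refine (norm_iteratedFDeriv_le_inv_pow_four hm (hCn0 m) (hCf0 m) (hCn m) (hCf m) hξ).trans ?_
    have hη : 1 ≤ ‖(2 * R) • ξ‖ := by
      rw [norm_smul, Real.norm_of_nonneg h2R.le]
      calc (1 : ℝ) = (2 * R) * (2 * R)⁻¹ := (mul_inv_cancel₀ h2R.ne').symm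
        _ ≤ (2 * R) * ‖ξ‖ := by gcongr
    have hJ := inv_pow_four_le_sixteen_mul_rpow hη
    have heq : (‖ξ‖ ^ 4)⁻¹ = (2 * R) ^ 4 * (‖(2 * R) • ξ‖ ^ 4)⁻¹ := by
      rw [norm_smul, Real.norm_of_nonneg h2R.le]
      field_simp
    have := hCn0 m; have := hCf0 m
    rw [heq]
    calc (Cn m + Cf m) * ((2 * R) ^ 4 * (‖(2 * R) • ξ‖ ^ 4)⁻¹)
        ≤ (Cn m + Cf m) * ((2 * R) ^ 4 * (16 * (1 + ‖(2 * R) • ξ‖) ^ (-(4 : ℝ)))) := by gcongr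
      _ = (Cn m + Cf m) * (16 * (2 * R) ^ 4 * (1 + ‖(2 * R) • ξ‖) ^ (-(4 : ℝ))) := by ring
  -- the second term
  have hT2 : ‖iteratedFDeriv ℝ m (fun η => χ (R • η) • F η) ξ‖ ≤
      (∑ i ∈ Finset.range (m + 1), (m.choose i : ℝ) * Mχ i * (Cn (m - i) * 2 ^ (m - i))) *
        (R ^ m * R⁻¹) * (closedBall (0 : E3) R⁻¹).indicator (fun _ => (1 : ℝ)) ξ := by
    refine (norm_iteratedFDeriv_smul_le_off_zero hθ.contDiffOn hF hξ m).trans ?_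
    by_cases hin : ‖ξ‖ ≤ R⁻¹
    · have hind : (closedBall (0 : E3) R⁻¹).indicator (fun _ => (1 : ℝ)) ξ = 1 := by
        rw [Set.indicator_of_mem (by simpa using hin)]
      rw [hind, mul_one, Finset.sum_mul]
      refine Finset.sum_le_sum fun i hi => ?_
      have hi' : i ≤ m := Nat.lt_succ_iff.1 (Finset.mem_range.1 hi)
      have hRm : R ^ i * R ^ (m - i) = R ^ m := by rw [← pow_add, Nat.add_sub_cancel' hi']
      have hA := norm_iteratedFDeriv_comp_smul_le hχ (hMχ i) hR0.le ξ
      have hB := norm_iteratedFDeriv_le_on_annulus (hCn0 (m - i)) (hCn (m - i)) hR hsmall hin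
      have := hM0 i; have := hCn0 (m - i)
      calc (m.choose i : ℝ) * ‖iteratedFDeriv ℝ i (fun η => χ (R • η)) ξ‖ *
            ‖iteratedFDeriv ℝ (m - i) F ξ‖
          ≤ (m.choose i : ℝ) * (Mχ i * R ^ i) * (Cn (m - i) * R⁻¹ * (2 * R) ^ (m - i)) := by
            gcongr
        _ = (m.choose i : ℝ) * Mχ i * (Cn (m - i) * 2 ^ (m - i)) *
              ((R ^ i * R ^ (m - i)) * R⁻¹) := by rw [mul_pow]; ring
        _ = (m.choose i : ℝ) * Mχ i * (Cn (m - i) * 2 ^ (m - i)) * (R ^ m * R⁻¹) := by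
            rw [hRm]
    · push Not at hin
      have hz : ∀ i, iteratedFDeriv ℝ i (fun η => χ (R • η)) ξ = 0 := fun i =>
        iteratedFDeriv_comp_smul_eq_zero hχ0 hR0 hin i
      simp only [hz, norm_zero, mul_zero, zero_mul, Finset.sum_const_zero]
      have : 0 ≤ R ^ m * R⁻¹ := by positivity
      positivity
  rw [hsub]
  exact (norm_sub_le _ _).trans (add_le_add hT1 hT2)

/-- The far piece `(1 - χ(R·))F` is smooth on all of `ℝ³` (it vanishes near the origin). -/
theorem contDiff_far_piece {F : E3 → ℂ} (hF : ContDiffOn ℝ ∞ F {0}ᶜ) {χ : E3 → ℝ}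
    (hχ : ContDiff ℝ ∞ χ) (hχ1 : ∀ η, ‖η‖ ≤ 2⁻¹ → χ η = 1) {R : ℝ} (hR : 0 < R) :
    ContDiff ℝ ∞ (fun η => F η - χ (R • η) • F η) := by
  have hθ : ContDiff ℝ ∞ (fun η : E3 => χ (R • η)) := hχ.comp (contDiff_const_smul R)
  refine contDiff_iff_contDiffAt.2 fun ξ => ?_
  by_cases hsmall : ‖ξ‖ < (2 * R)⁻¹
  · have hev : (fun η => F η - χ (R • η) • F η) =ᶠ[𝓝 ξ] fun _ => (0 : ℂ) := by
      filter_upwards [comp_smul_eventuallyEq_one hχ1 hR hsmall] with η hη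
      rw [hη, one_smul, sub_self]
    exact (contDiffAt_const (c := (0 : ℂ))).congr_of_eventuallyEq hev
  · push Not at hsmall
    have ht : 0 < ‖ξ‖ := lt_of_lt_of_le (by positivity) hsmall
    have hξ : ξ ≠ 0 := norm_pos_iff.1 ht
    have hFat : ContDiffAt ℝ ∞ F ξ := hF.contDiffAt (isOpen_compl_singleton.mem_nhds hξ)
    exact hFat.sub (hθ.contDiffAt.smul hFat)

/-- **Five integrations by parts**: `|x|⁵ |𝓕[(1 - χ(R·))F](x)| ≤ 32 ∑_{m ≤ 5} ‖Dᵐ[(1-χ(R·))F]‖₁ = O(R)`. -/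
theorem pow_mul_norm_fourier_far_piece_le {F : E3 → ℂ} (hF : ContDiffOn ℝ ∞ F {0}ᶜ)
    (Cn Cf : ℕ → ℝ) (hCn0 : ∀ j, 0 ≤ Cn j) (hCf0 : ∀ j, 0 ≤ Cf j)
    (hCn : ∀ j (ξ : E3), ξ ≠ 0 → ‖ξ‖ ≤ 1 → ‖ξ‖ ^ j * ‖iteratedFDeriv ℝ j F ξ‖ ≤ Cn j * ‖ξ‖)
    (hCf : ∀ j (ξ : E3), 1 ≤ ‖ξ‖ → ‖ξ‖ ^ 4 * ‖iteratedFDeriv ℝ j F ξ‖ ≤ Cf j)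
    {χ : E3 → ℝ} (hχ : ContDiff ℝ ∞ χ) (hχ1 : ∀ η, ‖η‖ ≤ 2⁻¹ → χ η = 1)
    (hχ0 : ∀ η, 1 ≤ ‖η‖ → χ η = 0) (Mχ : ℕ → ℝ) (hMχ : ∀ i η, ‖iteratedFDeriv ℝ i χ η‖ ≤ Mχ i)
    {R : ℝ} (hR : 1 ≤ R) (x : E3) :
    ‖x‖ ^ 5 * ‖𝓕 (fun η => F η - χ (R • η) • F η) x‖ ≤
      32 * (∑ m ∈ Finset.range 6, ((Cn m + Cf m) * (32 * ∫ η : E3, (1 + ‖η‖) ^ (-(4 : ℝ))) +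
        (∑ i ∈ Finset.range (m + 1), (m.choose i : ℝ) * Mχ i * (Cn (m - i) * 2 ^ (m - i))) *
          (volume : Measure E3).real (ball 0 1))) * R := by
  have hR0 : 0 < R := by linarith
  set F₂ : E3 → ℂ := fun η => F η - χ (R • η) • F η with hF₂
  have hsm : ContDiff ℝ ∞ F₂ := contDiff_far_piece hF hχ hχ1 hR0
  have hM0 : ∀ i, 0 ≤ Mχ i := fun i => (norm_nonneg _).trans (hMχ i 0)
  -- majorants of the derivatives of order `≤ 5`
  have hmaj : ∀ m, m ≤ 5 → Integrable (fun v => ‖iteratedFDeriv ℝ m F₂ v‖) ∧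
      ∫ v, ‖iteratedFDeriv ℝ m F₂ v‖ ≤ ((Cn m + Cf m) * (32 * ∫ η : E3, (1 + ‖η‖) ^ (-(4 : ℝ))) +
        (∑ i ∈ Finset.range (m + 1), (m.choose i : ℝ) * Mχ i * (Cn (m - i) * 2 ^ (m - i))) *
          (volume : Measure E3).real (ball 0 1)) * R := by
    intro m hm
    have hL0 : 0 ≤ ∑ i ∈ Finset.range (m + 1),
        (m.choose i : ℝ) * Mχ i * (Cn (m - i) * 2 ^ (m - i)) :=
      Finset.sum_nonneg fun i _ => by have := hM0 i; have := hCn0 (m - i); positivity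
    obtain ⟨hGi, hGle⟩ := integral_majorant_le (K := Cn m + Cf m) hL0 hR hm
    have hpt := fun v =>
      norm_iteratedFDeriv_far_piece_le hF Cn Cf hCn0 hCf0 hCn hCf hχ hχ1 hχ0 Mχ hMχ hR hm v
    have hmeas : AEStronglyMeasurable (fun v => ‖iteratedFDeriv ℝ m F₂ v‖) volume :=
      (hsm.continuous_iteratedFDeriv (by exact_mod_cast le_top)).norm.aestronglyMeasurable
    have hint : Integrable (fun v => ‖iteratedFDeriv ℝ m F₂ v‖) :=
      hGi.mono' hmeas (Eventually.of_forall fun v => by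
        rw [Real.norm_of_nonneg (norm_nonneg _)]; exact hpt v)
    exact ⟨hint, (integral_mono hint hGi hpt).trans hGle⟩
  have hint' : ∀ (k n : ℕ), (k : ℕ∞) ≤ 0 → (n : ℕ∞) ≤ 5 →
      Integrable (fun v => ‖v‖ ^ k * ‖iteratedFDeriv ℝ n F₂ v‖) := by
    intro k n hk hn
    have hk0 : k = 0 := by exact_mod_cast nonpos_iff_eq_zero.1 hk
    have hn5 : n ≤ 5 := by exact_mod_cast hn
    subst hk0
    simp only [pow_zero, one_mul]
    exact (hmaj n hn5).1
  -- five integrations by parts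
  have h := Real.pow_mul_norm_iteratedFDeriv_fourier_le (K := 0) (N := 5) (f := F₂)
    (hsm.of_le (by exact_mod_cast le_top)) hint' (k := 0) (n := 5) (by simp) (by norm_num) x
  rw [norm_iteratedFDeriv_zero, Finset.sum_product, Finset.sum_range_one] at h
  simp only [pow_zero, one_mul, Nat.cast_zero, mul_zero, zero_add] at h
  norm_num at h
  have hsum : ∑ m ∈ Finset.range 6, ∫ v, ‖iteratedFDeriv ℝ m F₂ v‖ ≤
      (∑ m ∈ Finset.range 6, ((Cn m + Cf m) * (32 * ∫ η : E3, (1 + ‖η‖) ^ (-(4 : ℝ))) +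
        (∑ i ∈ Finset.range (m + 1), (m.choose i : ℝ) * Mχ i * (Cn (m - i) * 2 ^ (m - i))) *
          (volume : Measure E3).real (ball 0 1))) * R := by
    rw [Finset.sum_mul]
    exact Finset.sum_le_sum fun m hm =>
      (hmaj m (Nat.lt_succ_iff.1 (Finset.mem_range.1 hm))).2
  linarith [h, hsum]

/-! ### The near piece `χ(R·) F` and the kernel estimate -/

/-- **The near piece**: `|𝓕[χ(R·)F](x)| ≤ ‖χ(R·)F‖₁ ≤ C₀ R⁻¹ · vol(B(0,R⁻¹))`. -/
theorem norm_fourier_near_piece_le {F : E3 → ℂ} (hFm : AEStronglyMeasurable F volume) {C0 : ℝ}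
    (hC0 : 0 ≤ C0) (hF0 : ∀ ξ : E3, ξ ≠ 0 → ‖ξ‖ ≤ 1 → ‖F ξ‖ ≤ C0 * ‖ξ‖)
    {χ : E3 → ℝ} (hχc : Continuous χ) (hχ0 : ∀ η, 1 ≤ ‖η‖ → χ η = 0)
    (hχ01 : ∀ η, 0 ≤ χ η ∧ χ η ≤ 1) {R : ℝ} (hR : 1 ≤ R) (x : E3) :
    Integrable (fun η => χ (R • η) • F η) ∧
      ‖𝓕 (fun η => χ (R • η) • F η) x‖ ≤
        C0 * (volume : Measure E3).real (ball 0 1) * (R ^ 4)⁻¹ := by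
  have hR0 : 0 < R := by linarith
  set F₁ : E3 → ℂ := fun η => χ (R • η) • F η with hF₁
  set g : E3 → ℝ := (closedBall (0 : E3) R⁻¹).indicator (fun _ => C0 * R⁻¹) with hg
  have hgi : Integrable g :=
    (integrableOn_const (measure_closedBall_lt_top.ne)).integrable_indicator
      measurableSet_closedBall
  have hae : ∀ᵐ ξ : E3 ∂volume, ‖F₁ ξ‖ ≤ g ξ := by
    filter_upwards [compl_mem_ae_iff.mpr (measure_singleton (0 : E3))] with ξ hξ
    have hξ' : ξ ≠ 0 := hξ
    by_cases hin : ‖ξ‖ ≤ R⁻¹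
    · have h1 : ‖ξ‖ ≤ 1 := hin.trans (inv_le_one_of_one_le₀ hR)
      rw [hg, Set.indicator_of_mem (by simpa using hin), hF₁]
      simp only
      rw [norm_smul, Real.norm_of_nonneg (hχ01 _).1]
      calc χ (R • ξ) * ‖F ξ‖ ≤ 1 * (C0 * ‖ξ‖) :=
            mul_le_mul (hχ01 _).2 (hF0 ξ hξ' h1) (norm_nonneg _) zero_le_one
        _ ≤ C0 * R⁻¹ := by rw [one_mul]; gcongr
    · push Not at hin
      have hz : χ (R • ξ) = 0 := by
        apply hχ0
        rw [norm_smul, Real.norm_of_nonneg hR0.le]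
        have h1 := mul_lt_mul_of_pos_left hin hR0
        rw [mul_inv_cancel₀ hR0.ne'] at h1
        exact h1.le
      rw [hF₁]
      simp only
      rw [hz, zero_smul, norm_zero]
      exact Set.indicator_nonneg (fun _ _ => by positivity) ξ
  have hF1m : AEStronglyMeasurable F₁ volume :=
    ((hχc.comp (continuous_const_smul R)).aestronglyMeasurable).smul hFm
  have hF1i : Integrable F₁ := hgi.mono' hF1m hae
  refine ⟨hF1i, ?_⟩
  calc ‖𝓕 F₁ x‖ ≤ ∫ ξ, ‖F₁ ξ‖ := VectorFourier.norm_fourierIntegral_le_integral_norm _ _ _ _ _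
    _ ≤ ∫ ξ, g ξ := integral_mono_ae hF1i.norm hgi hae
    _ = C0 * (volume : Measure E3).real (ball 0 1) * (R ^ 4)⁻¹ := by
        rw [hg, integral_indicator_const _ measurableSet_closedBall, smul_eq_mul,
          Measure.addHaar_real_closedBall _ _ (by positivity), finrank_E3]
        ring

/-- **Kernel estimate.** If `F : ℝ³ → ℂ` is smooth off the origin with `|ξ|ᵐ ‖DᵐF(ξ)‖ ≤ Cₘ |ξ|` on the
punctured unit ball and `|ξ|⁴ ‖DᵐF(ξ)‖ ≤ C'ₘ` off it (all `m`), then `F ∈ L¹` and `(1 + |x|)⁴ |𝓕 F(x)|` is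
bounded (Tao 2016, §1.1: the kernel of a degree-one homogeneous multiplier of a Schwartz function is
`O(|x|^{-d-1})`; here by a frequency cutoff at scale `|x|⁻¹` and five integrations by parts). -/
theorem fourier_decay_of_symbol_estimates {F : E3 → ℂ} (hF : ContDiffOn ℝ ∞ F {0}ᶜ)
    (hnear : ∀ m : ℕ, ∃ C, ∀ ξ : E3, ξ ≠ 0 → ‖ξ‖ ≤ 1 →
      ‖ξ‖ ^ m * ‖iteratedFDeriv ℝ m F ξ‖ ≤ C * ‖ξ‖)
    (hfar : ∀ m : ℕ, ∃ C, ∀ ξ : E3, 1 ≤ ‖ξ‖ → ‖ξ‖ ^ 4 * ‖iteratedFDeriv ℝ m F ξ‖ ≤ C) :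
    Integrable F ∧ ∃ C, ∀ x : E3, (1 + ‖x‖) ^ 4 * ‖𝓕 F x‖ ≤ C := by
  -- nonnegative constants
  choose Cn' hCn' using hnear
  choose Cf' hCf' using hfar
  set Cn : ℕ → ℝ := fun m => max (Cn' m) 0 with hCn_def
  set Cf : ℕ → ℝ := fun m => max (Cf' m) 0 with hCf_def
  have hCn0 : ∀ m, 0 ≤ Cn m := fun m => le_max_right _ _
  have hCf0 : ∀ m, 0 ≤ Cf m := fun m => le_max_right _ _
  have hCn : ∀ m (ξ : E3), ξ ≠ 0 → ‖ξ‖ ≤ 1 →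
      ‖ξ‖ ^ m * ‖iteratedFDeriv ℝ m F ξ‖ ≤ Cn m * ‖ξ‖ := fun m ξ hξ h1 =>
    (hCn' m ξ hξ h1).trans (mul_le_mul_of_nonneg_right (le_max_left _ _) (norm_nonneg _))
  have hCf : ∀ m (ξ : E3), 1 ≤ ‖ξ‖ → ‖ξ‖ ^ 4 * ‖iteratedFDeriv ℝ m F ξ‖ ≤ Cf m :=
    fun m ξ h1 => (hCf' m ξ h1).trans (le_max_left _ _)
  -- the cutoff
  obtain ⟨χ, hχ, hχ1, hχ0, hχ01, hχM⟩ := exists_smooth_cutoff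
  choose Mχ hMχ using hχM
  -- measurability and the order-zero bounds
  have hae0 : ∀ᵐ ξ : E3 ∂volume, ξ ∈ ({0}ᶜ : Set E3) :=
    compl_mem_ae_iff.mpr (measure_singleton (0 : E3))
  have hFm : AEStronglyMeasurable F volume := by
    have h1 : AEStronglyMeasurable F (volume.restrict ({0}ᶜ : Set E3)) :=
      hF.continuousOn.aestronglyMeasurable (measurableSet_singleton 0).compl
    rwa [Measure.restrict_eq_self_of_ae_mem hae0] at h1
  have hF0 : ∀ ξ : E3, ξ ≠ 0 → ‖ξ‖ ≤ 1 → ‖F ξ‖ ≤ Cn 0 * ‖ξ‖ := fun ξ hξ h1 => by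
    simpa [norm_iteratedFDeriv_zero] using hCn 0 ξ hξ h1
  have hF0' : ∀ ξ : E3, 1 ≤ ‖ξ‖ → ‖F ξ‖ ≤ Cf 0 * (‖ξ‖ ^ 4)⁻¹ := fun ξ h1 => by
    have h := hCf 0 ξ h1
    rw [norm_iteratedFDeriv_zero] at h
    have hp : 0 < ‖ξ‖ ^ 4 := by positivity
    rw [← div_eq_mul_inv, le_div_iff₀ hp]
    linarith
  -- integrability of `F`
  have hFi : Integrable F := by
    have hmaj : Integrable (fun ξ : E3 => (Cn 0 + Cf 0) * (16 * (1 + ‖ξ‖) ^ (-(4 : ℝ)))) :=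
      (integrable_japaneseBracket.const_mul 16).const_mul _
    refine hmaj.mono' hFm ?_
    filter_upwards [hae0] with ξ hξ
    have hξ' : ξ ≠ 0 := hξ
    have := hCn0 0
    have := hCf0 0
    rcases le_or_gt ‖ξ‖ 1 with h1 | h1
    · calc ‖F ξ‖ ≤ Cn 0 * ‖ξ‖ := hF0 ξ hξ' h1
        _ ≤ (Cn 0 + Cf 0) * 1 := by nlinarith [norm_nonneg ξ]
        _ ≤ (Cn 0 + Cf 0) * (16 * (1 + ‖ξ‖) ^ (-(4 : ℝ))) := by
            gcongr; exact one_le_sixteen_mul_rpow h1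
    · calc ‖F ξ‖ ≤ Cf 0 * (‖ξ‖ ^ 4)⁻¹ := hF0' ξ h1.le
        _ ≤ (Cn 0 + Cf 0) * (‖ξ‖ ^ 4)⁻¹ := by gcongr; linarith
        _ ≤ (Cn 0 + Cf 0) * (16 * (1 + ‖ξ‖) ^ (-(4 : ℝ))) := by
            gcongr; exact inv_pow_four_le_sixteen_mul_rpow h1.le
  refine ⟨hFi, ?_⟩
  -- the constants
  set v : ℝ := (volume : Measure E3).real (ball 0 1) with hv
  set S : ℝ := ∑ m ∈ Finset.range 6, ((Cn m + Cf m) * (32 * ∫ η : E3, (1 + ‖η‖) ^ (-(4 : ℝ))) +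
    (∑ i ∈ Finset.range (m + 1), (m.choose i : ℝ) * Mχ i * (Cn (m - i) * 2 ^ (m - i))) * v)
    with hS
  refine ⟨max (16 * (Cn 0 * v + 32 * S)) (16 * ∫ ξ, ‖F ξ‖), fun x => ?_⟩
  rcases le_or_gt ‖x‖ 1 with hx | hx
  · -- small `x`
    refine le_trans ?_ (le_max_right _ _)
    have h1 : ‖𝓕 F x‖ ≤ ∫ ξ, ‖F ξ‖ := VectorFourier.norm_fourierIntegral_le_integral_norm _ _ _ _ _
    have h2 : (1 + ‖x‖) ^ 4 ≤ 16 := by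
      calc (1 + ‖x‖) ^ 4 ≤ (2 : ℝ) ^ 4 := by gcongr; linarith
        _ = 16 := by norm_num
    have h3 : 0 ≤ ∫ ξ, ‖F ξ‖ := integral_nonneg fun _ => norm_nonneg _
    exact mul_le_mul h2 h1 (norm_nonneg _) (by norm_num)
  · -- large `x`: split at frequency scale `R⁻¹`, `R = ‖x‖`
    refine le_trans ?_ (le_max_left _ _)
    have hR1 : 1 ≤ ‖x‖ := hx.le
    have hR0 : 0 < ‖x‖ := by linarith
    obtain ⟨hF1i, hnearx⟩ :=
      norm_fourier_near_piece_le hFm (hCn0 0) hF0 hχ.continuous hχ0 hχ01 hR1 x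
    have hfarx :=
      pow_mul_norm_fourier_far_piece_le hF Cn Cf hCn0 hCf0 hCn hCf hχ hχ1 hχ0 Mχ hMχ hR1 x
    have hF2i : Integrable (fun η => F η - χ (‖x‖ • η) • F η) := hFi.sub hF1i
    have hsplit : 𝓕 F x = 𝓕 (fun η => χ (‖x‖ • η) • F η) x +
        𝓕 (fun η => F η - χ (‖x‖ • η) • F η) x := by
      have hfg : F = (fun η => χ (‖x‖ • η) • F η) + fun η => F η - χ (‖x‖ • η) • F η := by
        funext η; simp
      have hL : Continuous fun p : E3 × E3 => innerₗ E3 p.1 p.2 := continuous_inner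
      have hadd := VectorFourier.fourierIntegral_add Real.continuous_fourierChar hL hF1i hF2i
      conv_lhs => rw [hfg]
      exact congrFun hadd x
    have hfar' : ‖𝓕 (fun η => F η - χ (‖x‖ • η) • F η) x‖ ≤ 32 * S * ‖x‖ * (‖x‖ ^ 5)⁻¹ := by
      have h5 : 0 < ‖x‖ ^ 5 := by positivity
      rw [← div_eq_mul_inv, le_div_iff₀ h5]
      calc ‖𝓕 (fun η => F η - χ (‖x‖ • η) • F η) x‖ * ‖x‖ ^ 5
          = ‖x‖ ^ 5 * ‖𝓕 (fun η => F η - χ (‖x‖ • η) • F η) x‖ := by ring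
        _ ≤ 32 * S * ‖x‖ := hfarx
    have h16 : (1 + ‖x‖) ^ 4 ≤ 16 * ‖x‖ ^ 4 := by
      calc (1 + ‖x‖) ^ 4 ≤ (2 * ‖x‖) ^ 4 := by gcongr; linarith
        _ = 16 * ‖x‖ ^ 4 := by ring
    calc (1 + ‖x‖) ^ 4 * ‖𝓕 F x‖
        ≤ (16 * ‖x‖ ^ 4) * (Cn 0 * v * (‖x‖ ^ 4)⁻¹ + 32 * S * ‖x‖ * (‖x‖ ^ 5)⁻¹) := by
          rw [hsplit]
          exact mul_le_mul h16 ((norm_add_le _ _).trans (add_le_add hnearx hfar')) (norm_nonneg _)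
            (by positivity)
      _ = 16 * (Cn 0 * v + 32 * S) := by
          field_simp

/-- **Decay of the kernel of a homogeneous symbol applied to a Schwartz function**: for `ρ` smooth off the origin
and positively homogeneous of degree `k ≥ 1` and `T` Schwartz, `Φ = ρ • T` is integrable and
`(1 + |x|)⁴ |𝓕 Φ(x)| ≤ C`. -/
theorem fourier_decay_of_homogeneous {ρ : E3 → ℝ} {k : ℕ} (hk : 1 ≤ k)
    (hρ : ContDiffOn ℝ ∞ ρ {0}ᶜ) (hhom : ∀ t : ℝ, 0 < t → ∀ ξ, ρ (t • ξ) = t ^ k * ρ ξ)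
    (T : 𝓢(E3, ℂ)) :
    Integrable (fun ξ => ρ ξ • T ξ) ∧
      ∃ C, ∀ x : E3, (1 + ‖x‖) ^ 4 * ‖𝓕 (fun ξ => ρ ξ • T ξ) x‖ ≤ C := by
  obtain ⟨hΦ, hnear, hfar⟩ := symbol_estimates_of_homogeneous hk hρ hhom T
  exact fourier_decay_of_symbol_estimates hΦ hnear hfar

end JetDecay

/-- **Helper sub-goal `stub_jetDecay_kernel`** (registered on the crux item as a sub-goal of `stub_jetDecay`): the
kernel estimate — a symbol smooth off the origin with `|ξ|ᵐ ‖DᵐF(ξ)‖ ≤ Cₘ |ξ|` on the punctured unit ball and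
`|ξ|⁴ ‖DᵐF(ξ)‖ ≤ C'ₘ` off it is integrable with `(1 + |x|)⁴ |𝓕F(x)|` bounded
(`JetDecay.fourier_decay_of_symbol_estimates`). -/
theorem stub_jetDecay_kernel :
    ∀ F : EuclideanSpace ℝ (Fin 3) → ℂ, ContDiffOn ℝ (⊤ : ℕ∞) F {0}ᶜ → (∀ m : ℕ, ∃ C : ℝ, ∀ ξ : EuclideanSpace ℝ
      (Fin 3), ξ ≠ 0 → ‖ξ‖ ≤ 1 → ‖ξ‖ ^ m * ‖iteratedFDeriv ℝ m F ξ‖ ≤ C * ‖ξ‖) → (∀ m : ℕ, ∃ C : ℝ, ∀ ξ :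
      EuclideanSpace ℝ (Fin 3), 1 ≤ ‖ξ‖ → ‖ξ‖ ^ 4 * ‖iteratedFDeriv ℝ m F ξ‖ ≤ C) → MeasureTheory.Integrable F ∧
      ∃ C : ℝ, ∀ x : EuclideanSpace ℝ (Fin 3), (1 + ‖x‖) ^ 4 * ‖FourierTransform.fourier F x‖ ≤ C :=
  fun _ hF hnear hfar => JetDecay.fourier_decay_of_symbol_estimates hF hnear hfar

end Summit.NavierStokesRegularity.NavierStokesRegularity.Theorems
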